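import Summits.CriticalPhenomena.PercolationContinuityZ3.Theorems.PercNearOneGluingNoHeavyQuantGateStepNFree
import Summits.CriticalPhenomena.PercolationContinuityZ3.Theorems.PercNearOneGluingNoHeavyQuantGateMoveBlobCells
import Summits.CriticalPhenomena.PercolationContinuityZ3.Theorems.PercNearOneGluingNoHeavyQuantDECAtTMixtures
import HarnessLib

/-!
# QUANT lane R8, T-DEC: THE RE-GATING LEMMA — the common engine of the 'decompose and re-gate to the common mean' certificate
# families (atomic re-gating, root-pattern / all-subsets opening, …): a law that is a finite mixture of SDEC pieces is, under an outer
# gate `a` with `a·S ≤` every piece's mean, DEC at every layer at floor `a·x` (each piece re-gated to the target `a·S`)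

builds on p205010 (kernel theorem, internal audit signed; external expert review pending)

Support file (`--supports stmt-CriticalPhenomena-4575`), QUANT lane typer seat prim-quant-stmt (gen 39), rung R8 of
`run/shared/lean/prim/quant/LADDER.md`.  Theorems only, standard axioms, no sorries, no definitions.  Abstracted from typer g39's
`decAt_gate_flaw_atomic` (`…QuantAtomicRegating`, arm-1 g46's atomic identity) so that the other explicit families of README V400's
programme (lead g42's all-subsets opening identity, root-pattern re-gating, arm-1's version mixtures) become short corollaries:
supply a mixture decomposition of the forest law into pieces with known means and SDEC floors, check the regime and the floors.

THE LEMMA (`decAt_gate_of_regate`).  Data: a law `μ` on `{0..M}` with mean `S > 0` and a finite mixture `μ = Σᵢ πᵢ·Fᵢ` (`πᵢ ≥ 0`, `Σ πᵢ = 1`,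
`Σ πᵢ sᵢ = S`) whose charged pieces `Fᵢ` are probability laws on `{0..tᵢ}`, `tᵢ ≤ M`, of mean `sᵢ`, SDEC at a floor `0 < yᵢ < 1` with
`yᵢ·tᵢ ≤ sᵢ`.  Hypotheses: outer gate `0 < a` with `a·S ≤ sᵢ` (REGIME: every re-gate `gᵢ = a·S/sᵢ ≤ 1`) and `x·sᵢ ≤ S·yᵢ` (FLOOR: `gᵢ·yᵢ ≥ a·x`)
for every charged `i`.  Conclusion: `gate μ a` is DEC at every layer `j < M` at floor `a·x`, by the certificate
`gate μ a = Σᵢ (πᵢsᵢ/S)·gate_{gᵢ} Fᵢ` (`regate_identity`) + `decAtT_mixture_finset` + `sdec_gate` / Theorem A per piece.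

HONEST STATUS: a tool; `SiblingStep`, `GateStepN`, `FarTreeRow` OPEN; RATE class log\* / honest sentence unchanged.
[this work].  Nothing here is cited as a published result.  The gluing rows served [cite: KozmaNitzan2024, Conjecture 3 (p. 15)]; product
measure [cite: Grimmett1999, §1.3 p. 10].
-/

noncomputable section

open scoped BigOperators

namespace Summit.CriticalPhenomena.PercolationContinuityZ3.Theorems
namespace Quant
namespace LawDec

open Finset

/-- **THE RE-GATING IDENTITY**: if `μ = Σ πᵢ Fᵢ` pointwise with `Σ πᵢ = 1` and `Σ πᵢ sᵢ = S ≠ 0`, `sᵢ ≠ 0` on the charged pieces, then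
`gate μ a = Σᵢ (πᵢ sᵢ / S)·gate Fᵢ (a S / sᵢ)` pointwise. [this work] -/
theorem regate_identity {ι : Type*} [Fintype ι] (μ : ℕ → ℝ) (π : ι → ℝ) (F : ι → ℕ → ℝ) (s : ι → ℝ) {S a : ℝ}
    (hπ1 : ∑ i, π i = 1) (hmix : ∀ h, μ h = ∑ i, π i * F i h) (hS : ∑ i, π i * s i = S) (hS0 : S ≠ 0)
    (hs : ∀ i, π i ≠ 0 → s i ≠ 0) (h : ℕ) :
    gate μ a h = ∑ i, (π i * s i / S) * gate (F i) (a * S / s i) h := by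
  have hwg : ∀ i, (π i * s i / S) * (a * S / s i) = a * π i := by
    intro i
    by_cases hz : π i = 0
    · rw [hz]; ring
    · field_simp [hs i hz, hS0]
  have hw1 : ∑ i, π i * s i / S = 1 := by rw [← Finset.sum_div, hS, div_self hS0]
  have e : ∀ i, (π i * s i / S) * gate (F i) (a * S / s i) h
      = a * (π i * F i h) + (if h = 0 then (1 : ℝ) else 0) * (π i * s i / S - a * π i) := by
    intro i
    rw [gate_apply, mul_add, ← mul_assoc, hwg i]
    have : π i * s i / S * ((1 - a * S / s i) * (if h = 0 then (1 : ℝ) else 0))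
        = (if h = 0 then (1 : ℝ) else 0) * (π i * s i / S - π i * s i / S * (a * S / s i)) := by ring
    rw [this, hwg i]; ring
  rw [Finset.sum_congr rfl fun i _ => e i, Finset.sum_add_distrib, ← Finset.mul_sum, ← Finset.mul_sum, Finset.sum_sub_distrib,
    ← Finset.mul_sum, hw1, hπ1, ← hmix h, gate_apply]
  ring

/-- **THE RE-GATING LEMMA.**  A law `μ` on `{0..M}` of mean `S > 0` that is a finite mixture `Σ πᵢ Fᵢ` of pieces which (when charged) are
probability laws on `{0..tᵢ}`, `tᵢ ≤ M`, of mean `sᵢ`, SDEC at a floor `0 < yᵢ < 1` with `yᵢ·tᵢ ≤ sᵢ`: for an outer gate `0 < a` in the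
REGIME `a·S ≤ sᵢ` and with the FLOORS `x·sᵢ ≤ S·yᵢ` (charged `i`; `0 < x`), `gate μ a` is DEC at every layer `j < M` at floor `a·x`.
[this work] -/
theorem decAt_gate_of_regate {ι : Type*} [Fintype ι] (M : ℕ) (μ : ℕ → ℝ) (π : ι → ℝ) (F : ι → ℕ → ℝ) (t : ι → ℕ)
    (s y : ι → ℝ) {S x a : ℝ}
    (hπ0 : ∀ i, 0 ≤ π i) (hπ1 : ∑ i, π i = 1) (hmix : ∀ h, μ h = ∑ i, π i * F i h) (hS : ∑ i, π i * s i = S) (hS0 : 0 < S)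
    (hμ : ∑ h ∈ Finset.range (M + 1), (h : ℝ) * μ h = S)
    (hF : ∀ i, 0 < π i → t i ≤ M ∧ (∀ h, 0 ≤ F i h) ∧ (∀ h, t i < h → F i h = 0) ∧ (∑ h ∈ Finset.range (t i + 1), F i h = 1) ∧
      (∑ h ∈ Finset.range (t i + 1), (h : ℝ) * F i h = s i) ∧ 0 < y i ∧ y i < 1 ∧ y i * (t i : ℝ) ≤ s i ∧ SDEC (y i) (t i) (F i))
    (hx0 : 0 < x) (ha0 : 0 < a) (hreg : ∀ i, 0 < π i → a * S ≤ s i) (hfl : ∀ i, 0 < π i → x * s i ≤ S * y i) :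
    ∀ j, j < M → DECAt (a * x) j M (gate μ a) := by
  classical
  intro j _
  have haS : 0 < a * S := mul_pos ha0 hS0
  have hspos : ∀ i, 0 < π i → 0 < s i := fun i hi => lt_of_lt_of_le haS (hreg i hi)
  have hs : ∀ i, π i ≠ 0 → s i ≠ 0 := fun i hi => (hspos i ((hπ0 i).lt_of_ne (Ne.symm hi))).ne'
  -- weights
  have hw0 : ∀ i, 0 ≤ π i * s i / S := by
    intro i
    rcases (hπ0 i).eq_or_lt with hz | hpos
    · rw [← hz, zero_mul, zero_div]
    · exact div_nonneg (mul_nonneg hpos.le (hspos i hpos).le) hS0.le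
  have hw1 : ∑ i, π i * s i / S = 1 := by rw [← Finset.sum_div, hS, div_self hS0.ne']
  -- every charged piece, re-gated, is DEC at `(a·x, a·S, j)` on `{0..M}`
  have hcomp : ∀ i, 0 < π i * s i / S → DECAtT (a * x) (a * S) j M (gate (F i) (a * S / s i)) := by
    intro i hwi
    have hπi : 0 < π i := by
      by_contra hle
      have hz : π i = 0 := le_antisymm (not_lt.1 hle) (hπ0 i)
      rw [hz, zero_mul, zero_div] at hwi; exact lt_irrefl _ hwi
    obtain ⟨hti, F0, FM, F1, Fmean, hy0, hy1, hyt, hSi⟩ := hF i hπi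
    have hsi := hspos i hπi
    set g : ℝ := a * S / s i with hg
    have hg0 : 0 < g := div_pos haS hsi
    have hg1 : g ≤ 1 := by rw [hg, div_le_one hsi]; exact hreg i hπi
    have hgs : g * s i = a * S := by rw [hg]; exact div_mul_cancel₀ _ hsi.ne'
    have hSg : SDEC (g * y i) (t i) (gate (F i) g) := sdec_gate hSi g hg0 hg1
    have hfloor : a * x ≤ g * y i := by
      rw [hg, div_mul_eq_mul_div, le_div_iff₀ hsi]
      have := mul_le_mul_of_nonneg_left (hfl i hπi) ha0.le
      linarith
    have hgy1 : g * y i < 1 := by nlinarith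
    have hax1 : a * x < 1 := lt_of_le_of_lt hfloor hgy1
    have G0 : ∀ h, 0 ≤ gate (F i) g h := by
      intro h; simp only [LawDec.gate]; split_ifs <;> nlinarith [F0 h]
    have GM : ∀ h, t i < h → gate (F i) g h = 0 := by
      intro h hh; simp only [LawDec.gate]; rw [FM h hh, if_neg (by omega)]; ring
    have G1 : ∑ h ∈ Finset.range (t i + 1), gate (F i) g h = 1 := sum_gate _ _ _ F1
    have Gmean : ∑ h ∈ Finset.range (t i + 1), (h : ℝ) * gate (F i) g h = a * S := by rw [sum_mul_gate, Fmean, hgs]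
    have Gta : ∀ h, 0 < gate (F i) g h → (a * x) * (h : ℝ) ≤ ∑ k ∈ Finset.range (t i + 1), (k : ℝ) * gate (F i) g k := by
      intro h hh
      rw [Gmean]
      have hht : h ≤ t i := by
        by_contra hlt; exact absurd (GM h (not_le.1 hlt)) hh.ne'
      have h1 : (a * x) * (h : ℝ) ≤ (a * x) * (t i : ℝ) := mul_le_mul_of_nonneg_left (by exact_mod_cast hht) (by positivity)
      have h2 : (a * x) * (t i : ℝ) ≤ (g * y i) * (t i : ℝ) := mul_le_mul_of_nonneg_right hfloor (Nat.cast_nonneg _)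
      have h3 : g * (y i * (t i : ℝ)) ≤ g * s i := mul_le_mul_of_nonneg_left hyt hg0.le
      nlinarith
    have hall : DECAt (a * x) j (t i) (gate (F i) g) := by
      by_cases hlt : j < t i
      · have hd := hSg 1 one_pos le_rfl j hlt
        rw [gate_one, one_mul] at hd
        exact decAt_mono_floor hfloor hgy1 hd
      · exact decAt_of_top_le (t i) _ G0 GM G1 (a * x) hax1 Gta j (not_lt.1 hlt)
    rw [decAt_iff_decAtT, Gmean] at hall
    exact decAtT_mono_top hall hti
  -- assemble
  have hmeanG : ∑ h ∈ Finset.range (M + 1), (h : ℝ) * gate μ a h = a * S := by rw [sum_mul_gate, hμ]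
  rw [decAt_iff_decAtT, hmeanG]
  exact decAtT_congr (fun h => (regate_identity μ π F s hπ1 hmix hS hS0.ne' hs h).symm)
    (decAtT_mixture_finset Finset.univ (fun i => π i * s i / S) (fun i => gate (F i) (a * S / s i))
      (fun i _ => hw0 i) hw1 (fun i _ hwi => hcomp i hwi))

end LawDec
end Quant
end Summit.CriticalPhenomena.PercolationContinuityZ3.Theorems
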